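import Mathlib
import Literature.Probability.LatticeModels.BrillouinRiemannSumUniform
import Summits.HubbardSuperconductivity.HubbardSuperconductivity.Theorems.BalabanIRBirBdGPhaseCoercivityLyapunovFinal

/-!
# Route BalabanIR — crux 4R `BirGappedPhaseReductionR` (item `stmt-HubbardSuperconductivity-14846`):
# block-London coercivity IV — positivity of the kernel structure factor away from zero momentum

For the `d+id` BdG reference of crux 3 (`μ ∈ (-4,4)`, `Δ₁ Δ₂ ≠ 0`) let `f = Δ/E` be the
anomalous-amplitude symbol and `S_L(q) = N⁻¹ Σ_k |f_k - f_{k+q}|²` the structure factor that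
controls the block-London inequality (`blockLondon_of_kernelSymbolIneq`, file `…BlockLondon`).
THEOREM (`kernelSymbol_pos_far`): for every `r₀ > 0` there are `s₀ > 0` and `L₀` such that for
all even `L ≥ L₀` and every texture momentum `q` whose lattice momentum `2πq/L` is at sup-distance
`≥ r₀` from `2πℤ²`, `S_L(q) ≥ s₀`.
PROOF. `S_L(q)` is the momentum average of the continuous doubly periodic function
`G(k, p) = |f(k) - f(k+p)|²` at `p = 2πq/L`; by `momentumAverage_uniform_approx` (Literature,
uniform Riemann sums) it is within any `ε` of `(2π)⁻² ∫_{[-π,π]²} G(·, p)` uniformly on the compact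
set `C = {p ∈ [0,2π]² : dist(p, 2πℤ²) ≥ r₀}`, on which the continuous (parametric integral) function
`p ↦ ∫ G(·,p)` is positive — `∫ G(·,p) = 0` would force `f(· + p) ≡ f`, impossible for
`p ∉ 2πℤ²`: `f(0) = 0 ≠ f(p)` unless `Δ(p) = 0`, i.e. `p ≡ 0` or `p ≡ (π,π)`, and in the latter case
`f(π/2,0) = -2Δ₁/E ≠ +2Δ₁/E' = f(3π/2, π)` — hence bounded below by a positive minimum.
This is hypothesis (K2) of the proof plan for the kernel symbol inequality recorded on the item
(evidence `Prover1_14846_s8_block_london.md`); no definition is introduced.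
-/

noncomputable section

namespace Summit.HubbardSuperconductivity.HubbardSuperconductivity.Theorems

namespace BirBdG

open MeasureTheory Finset Literature.Probability.LatticeModels
open scoped ComplexConjugate

/-! ### The continuum symbol `f = Δ/E` : continuity, periodicity, special values -/

section Continuum

variable (μ Δ₁ Δ₂ : ℝ)

/-- The continuum anomalous-amplitude symbol is continuous on `ℝ²` when the dispersion does not
vanish (`μ ∈ (-4,4)`, `Δ₁Δ₂ ≠ 0`). [folklore] -/
theorem continuous_symbolC (hμ : μ ∈ Set.Ioo (-4 : ℝ) 4) (h₁ : Δ₁ ≠ 0) (h₂ : Δ₂ ≠ 0)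
    (fc : (Fin 2 → ℝ) → ℂ)
    (hfc : ∀ p, fc p = (((2 * Δ₁ * (Real.cos (p 0) - Real.cos (p 1)) : ℝ) : ℂ) -
        4 * Complex.I * ((Δ₂ * Real.sin (p 0) * Real.sin (p 1) : ℝ) : ℂ)) /
      ((Real.sqrt ((-2 * Real.cos (p 0) - 2 * Real.cos (p 1) - μ) ^ 2 +
        ‖((2 * Δ₁ * (Real.cos (p 0) - Real.cos (p 1)) : ℝ) : ℂ) -
          4 * Complex.I * ((Δ₂ * Real.sin (p 0) * Real.sin (p 1) : ℝ) : ℂ)‖ ^ 2) : ℝ) : ℂ)) :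
    Continuous fc := by
  have hf : fc = fun p => (((2 * Δ₁ * (Real.cos (p 0) - Real.cos (p 1)) : ℝ) : ℂ) -
        4 * Complex.I * ((Δ₂ * Real.sin (p 0) * Real.sin (p 1) : ℝ) : ℂ)) /
      ((Real.sqrt ((-2 * Real.cos (p 0) - 2 * Real.cos (p 1) - μ) ^ 2 +
        ‖((2 * Δ₁ * (Real.cos (p 0) - Real.cos (p 1)) : ℝ) : ℂ) -
          4 * Complex.I * ((Δ₂ * Real.sin (p 0) * Real.sin (p 1) : ℝ) : ℂ)‖ ^ 2) : ℝ) : ℂ) :=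
    funext hfc
  rw [hf]
  refine Continuous.div (by fun_prop) (by fun_prop) fun p => ?_
  have hpos := bdg_dispersion_pos μ Δ₁ Δ₂ (p 0) (p 1) hμ h₁ h₂
  exact_mod_cast (Real.sqrt_pos.2 hpos).ne'

/-- The continuum symbol is `2π`-periodic in each coordinate. [folklore] -/
theorem symbolC_periodic (fc : (Fin 2 → ℝ) → ℂ)
    (hfc : ∀ p, fc p = (((2 * Δ₁ * (Real.cos (p 0) - Real.cos (p 1)) : ℝ) : ℂ) -
        4 * Complex.I * ((Δ₂ * Real.sin (p 0) * Real.sin (p 1) : ℝ) : ℂ)) /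
      ((Real.sqrt ((-2 * Real.cos (p 0) - 2 * Real.cos (p 1) - μ) ^ 2 +
        ‖((2 * Δ₁ * (Real.cos (p 0) - Real.cos (p 1)) : ℝ) : ℂ) -
          4 * Complex.I * ((Δ₂ * Real.sin (p 0) * Real.sin (p 1) : ℝ) : ℂ)‖ ^ 2) : ℝ) : ℂ))
    (p : Fin 2 → ℝ) (n : Fin 2 → ℤ) :
    fc (fun i => p i + 2 * Real.pi * (n i : ℝ)) = fc p := by
  have hc : ∀ i, Real.cos (p i + 2 * Real.pi * (n i : ℝ)) = Real.cos (p i) := fun i => by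
    rw [show 2 * Real.pi * (n i : ℝ) = (n i : ℝ) * (2 * Real.pi) by ring, Real.cos_add_int_mul_two_pi]
  have hs : ∀ i, Real.sin (p i + 2 * Real.pi * (n i : ℝ)) = Real.sin (p i) := fun i => by
    rw [show 2 * Real.pi * (n i : ℝ) = (n i : ℝ) * (2 * Real.pi) by ring, Real.sin_add_int_mul_two_pi]
  rw [hfc, hfc p]
  simp only [hc, hs]

/-- The continuum symbol vanishes at the origin (`Δ(0) = 0`). [folklore] -/
theorem symbolC_zero (fc : (Fin 2 → ℝ) → ℂ)
    (hfc : ∀ p, fc p = (((2 * Δ₁ * (Real.cos (p 0) - Real.cos (p 1)) : ℝ) : ℂ) -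
        4 * Complex.I * ((Δ₂ * Real.sin (p 0) * Real.sin (p 1) : ℝ) : ℂ)) /
      ((Real.sqrt ((-2 * Real.cos (p 0) - 2 * Real.cos (p 1) - μ) ^ 2 +
        ‖((2 * Δ₁ * (Real.cos (p 0) - Real.cos (p 1)) : ℝ) : ℂ) -
          4 * Complex.I * ((Δ₂ * Real.sin (p 0) * Real.sin (p 1) : ℝ) : ℂ)‖ ^ 2) : ℝ) : ℂ)) :
    fc 0 = 0 := by
  rw [hfc]
  simp

/-- Zeros of the continuum symbol: `f(p) = 0` forces `cos p₀ = cos p₁ ∈ {1, -1}`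
(`Δ₁, Δ₂ ≠ 0`, nonvanishing dispersion). [folklore] -/
theorem symbolC_eq_zero (hμ : μ ∈ Set.Ioo (-4 : ℝ) 4) (h₁ : Δ₁ ≠ 0) (h₂ : Δ₂ ≠ 0)
    (fc : (Fin 2 → ℝ) → ℂ)
    (hfc : ∀ p, fc p = (((2 * Δ₁ * (Real.cos (p 0) - Real.cos (p 1)) : ℝ) : ℂ) -
        4 * Complex.I * ((Δ₂ * Real.sin (p 0) * Real.sin (p 1) : ℝ) : ℂ)) /
      ((Real.sqrt ((-2 * Real.cos (p 0) - 2 * Real.cos (p 1) - μ) ^ 2 +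
        ‖((2 * Δ₁ * (Real.cos (p 0) - Real.cos (p 1)) : ℝ) : ℂ) -
          4 * Complex.I * ((Δ₂ * Real.sin (p 0) * Real.sin (p 1) : ℝ) : ℂ)‖ ^ 2) : ℝ) : ℂ))
    {p : Fin 2 → ℝ} (hp : fc p = 0) :
    (Real.cos (p 0) = 1 ∧ Real.cos (p 1) = 1) ∨ (Real.cos (p 0) = -1 ∧ Real.cos (p 1) = -1) := by
  have hpos := bdg_dispersion_pos μ Δ₁ Δ₂ (p 0) (p 1) hμ h₁ h₂
  have hden : ((Real.sqrt ((-2 * Real.cos (p 0) - 2 * Real.cos (p 1) - μ) ^ 2 +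
        ‖((2 * Δ₁ * (Real.cos (p 0) - Real.cos (p 1)) : ℝ) : ℂ) -
          4 * Complex.I * ((Δ₂ * Real.sin (p 0) * Real.sin (p 1) : ℝ) : ℂ)‖ ^ 2) : ℝ) : ℂ) ≠ 0 := by
    exact_mod_cast (Real.sqrt_pos.2 hpos).ne'
  rw [hfc, div_eq_zero_iff, or_iff_left hden] at hp
  have hre : Δ₁ = 0 ∨ Real.cos (p 0) - Real.cos (p 1) = 0 := by
    have := congrArg Complex.re hp
    simpa [Complex.cos_ofReal_re] using this
  have him : (Δ₂ = 0 ∨ Real.sin (p 0) = 0) ∨ Real.sin (p 1) = 0 := by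
    have := congrArg Complex.im hp
    simpa [Complex.sin_ofReal_re] using this
  -- `cos p₀ = cos p₁` and `sin p₀ sin p₁ = 0`
  have hcos : Real.cos (p 0) = Real.cos (p 1) := by
    rcases hre with h | h
    · exact absurd h h₁
    · linarith
  have hsin : Real.sin (p 0) = 0 ∨ Real.sin (p 1) = 0 := by
    rcases him with (h | h) | h
    · exact absurd h h₂
    · exact Or.inl h
    · exact Or.inr h
  rcases hsin with h | h
  · rcases Real.sin_eq_zero_iff_cos_eq.1 h with hc | hc
    · exact Or.inl ⟨hc, hcos ▸ hc⟩
    · exact Or.inr ⟨hc, hcos ▸ hc⟩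
  · rcases Real.sin_eq_zero_iff_cos_eq.1 h with hc | hc
    · exact Or.inl ⟨hcos.trans hc, hc⟩
    · exact Or.inr ⟨hcos.trans hc, hc⟩

/-- The two special values used in the positivity argument: at `k₀ = (π/2, 0)` the numerator is
`-2Δ₁`, and at `k₀ + p` with `cos pᵢ = -1` it is `+2Δ₁`; since the denominators are positive the
two values of `f` differ (`Δ₁ ≠ 0`). [folklore] -/
theorem symbolC_special_ne (hμ : μ ∈ Set.Ioo (-4 : ℝ) 4) (h₁ : Δ₁ ≠ 0) (h₂ : Δ₂ ≠ 0)
    (fc : (Fin 2 → ℝ) → ℂ)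
    (hfc : ∀ p, fc p = (((2 * Δ₁ * (Real.cos (p 0) - Real.cos (p 1)) : ℝ) : ℂ) -
        4 * Complex.I * ((Δ₂ * Real.sin (p 0) * Real.sin (p 1) : ℝ) : ℂ)) /
      ((Real.sqrt ((-2 * Real.cos (p 0) - 2 * Real.cos (p 1) - μ) ^ 2 +
        ‖((2 * Δ₁ * (Real.cos (p 0) - Real.cos (p 1)) : ℝ) : ℂ) -
          4 * Complex.I * ((Δ₂ * Real.sin (p 0) * Real.sin (p 1) : ℝ) : ℂ)‖ ^ 2) : ℝ) : ℂ))
    {p : Fin 2 → ℝ} (hc0 : Real.cos (p 0) = -1) (hc1 : Real.cos (p 1) = -1) :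
    fc ![Real.pi / 2, 0] ≠ fc (![Real.pi / 2, 0] + p) := by
  -- trigonometric values
  have hs0 : Real.sin (p 0) = 0 := by
    rcases Real.sin_eq_zero_iff_cos_eq.2 (Or.inr hc0) with h; exact h
  have hs1 : Real.sin (p 1) = 0 := by
    rcases Real.sin_eq_zero_iff_cos_eq.2 (Or.inr hc1) with h; exact h
  have hcA : Real.cos (Real.pi / 2 + p 0) = 0 := by
    rw [Real.cos_add, Real.cos_pi_div_two, Real.sin_pi_div_two, hs0]; ring
  have hsA : Real.sin (Real.pi / 2 + p 0) = -1 := by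
    rw [Real.sin_add, Real.cos_pi_div_two, Real.sin_pi_div_two, hc0, hs0]; ring
  have hcB : Real.cos (0 + p 1) = -1 := by rw [zero_add, hc1]
  have hsB : Real.sin (0 + p 1) = 0 := by rw [zero_add, hs1]
  -- the two denominators are positive reals
  set Ea : ℝ := Real.sqrt ((-2 * Real.cos (Real.pi / 2) - 2 * Real.cos 0 - μ) ^ 2 +
      ‖((2 * Δ₁ * (Real.cos (Real.pi / 2) - Real.cos 0) : ℝ) : ℂ) -
        4 * Complex.I * ((Δ₂ * Real.sin (Real.pi / 2) * Real.sin 0 : ℝ) : ℂ)‖ ^ 2) with hEa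
  set Eb : ℝ := Real.sqrt ((-2 * Real.cos (Real.pi / 2 + p 0) - 2 * Real.cos (0 + p 1) - μ) ^ 2 +
      ‖((2 * Δ₁ * (Real.cos (Real.pi / 2 + p 0) - Real.cos (0 + p 1)) : ℝ) : ℂ) -
        4 * Complex.I * ((Δ₂ * Real.sin (Real.pi / 2 + p 0) * Real.sin (0 + p 1) : ℝ) : ℂ)‖ ^ 2)
    with hEb
  have hEa_pos : 0 < Ea := Real.sqrt_pos.2 (bdg_dispersion_pos μ Δ₁ Δ₂ _ _ hμ h₁ h₂)
  have hEb_pos : 0 < Eb := Real.sqrt_pos.2 (bdg_dispersion_pos μ Δ₁ Δ₂ _ _ hμ h₁ h₂)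
  have hva : fc ![Real.pi / 2, 0] = ((-2 * Δ₁ : ℝ) : ℂ) / (Ea : ℂ) := by
    rw [hfc]
    simp only [Matrix.cons_val_zero, Matrix.cons_val_one, Matrix.cons_val_fin_one]
    rw [← hEa]
    congr 1
    rw [Real.cos_pi_div_two, Real.cos_zero, Real.sin_zero]
    push_cast
    ring
  have hvb : fc (![Real.pi / 2, 0] + p) = ((2 * Δ₁ : ℝ) : ℂ) / (Eb : ℂ) := by
    rw [hfc]
    simp only [Pi.add_apply, Matrix.cons_val_zero, Matrix.cons_val_one, Matrix.cons_val_fin_one]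
    rw [← hEb]
    congr 1
    rw [hcA, hsA, hcB, hsB]
    push_cast
    ring
  rw [hva, hvb]
  intro h
  have hEa' : (Ea : ℂ) ≠ 0 := by exact_mod_cast hEa_pos.ne'
  have hEb' : (Eb : ℂ) ≠ 0 := by exact_mod_cast hEb_pos.ne'
  rw [div_eq_div_iff hEa' hEb'] at h
  have h' := congrArg Complex.re h
  simp only [Complex.mul_re, Complex.ofReal_re, Complex.ofReal_im, mul_zero, sub_zero] at h'
  -- `-2Δ₁ Eb = 2Δ₁ Ea` with `Ea, Eb > 0` forces `Δ₁ = 0`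
  have : Δ₁ * (Ea + Eb) = 0 := by linarith
  rcases mul_eq_zero.1 this with h0 | h0
  · exact h₁ h0
  · linarith

/-- **Positivity of the continuum structure factor off the reciprocal lattice.**  For
`p ∉ 2πℤ²`, `0 < ∫_{[-π,π]²} |f(k) - f(k+p)|² dk` (the integrand is continuous, nonnegative and
not identically zero: `f(0) = 0 ≠ f(p)` unless `Δ(p) = 0`, i.e. `cos pᵢ = ±1`; `+1` means
`p ∈ 2πℤ²`, `-1` is excluded by `symbolC_special_ne`). [folklore] -/
theorem setIntegral_symbolC_diff_pos (hμ : μ ∈ Set.Ioo (-4 : ℝ) 4) (h₁ : Δ₁ ≠ 0) (h₂ : Δ₂ ≠ 0)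
    (fc : (Fin 2 → ℝ) → ℂ)
    (hfc : ∀ p, fc p = (((2 * Δ₁ * (Real.cos (p 0) - Real.cos (p 1)) : ℝ) : ℂ) -
        4 * Complex.I * ((Δ₂ * Real.sin (p 0) * Real.sin (p 1) : ℝ) : ℂ)) /
      ((Real.sqrt ((-2 * Real.cos (p 0) - 2 * Real.cos (p 1) - μ) ^ 2 +
        ‖((2 * Δ₁ * (Real.cos (p 0) - Real.cos (p 1)) : ℝ) : ℂ) -
          4 * Complex.I * ((Δ₂ * Real.sin (p 0) * Real.sin (p 1) : ℝ) : ℂ)‖ ^ 2) : ℝ) : ℂ))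
    {p : Fin 2 → ℝ} (hp : ∀ n : Fin 2 → ℤ, p ≠ fun i => 2 * Real.pi * (n i : ℝ)) :
    0 < ∫ k in brillouin 2, ‖fc k - fc (k + p)‖ ^ 2 := by
  have hcont := continuous_symbolC μ Δ₁ Δ₂ hμ h₁ h₂ fc hfc
  -- a point where the integrand is positive, well inside the zone
  have key : ∃ k₀ : Fin 2 → ℝ, (∀ i, |k₀ i| ≤ Real.pi / 2) ∧ fc k₀ ≠ fc (k₀ + p) := by
    by_cases hfp : fc p = 0
    · rcases symbolC_eq_zero μ Δ₁ Δ₂ hμ h₁ h₂ fc hfc hfp with ⟨hc0, hc1⟩ | ⟨hc0, hc1⟩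
      · exfalso
        obtain ⟨n0, hn0⟩ := (Real.cos_eq_one_iff (p 0)).1 hc0
        obtain ⟨n1, hn1⟩ := (Real.cos_eq_one_iff (p 1)).1 hc1
        refine hp ![n0, n1] (funext fun i => ?_)
        fin_cases i
        · simp only [Fin.zero_eta, Fin.isValue, Matrix.cons_val_zero]; linarith
        · simp only [Fin.mk_one, Fin.isValue, Matrix.cons_val_one, Matrix.cons_val_fin_one]; linarith
      · refine ⟨![Real.pi / 2, 0], fun i => ?_, symbolC_special_ne μ Δ₁ Δ₂ hμ h₁ h₂ fc hfc hc0 hc1⟩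
        fin_cases i
        · simp [abs_of_pos (half_pos Real.pi_pos)]
        · simpa using (half_pos Real.pi_pos).le
    · refine ⟨0, fun i => by simpa using (half_pos Real.pi_pos).le, ?_⟩
      rw [zero_add, symbolC_zero μ Δ₁ Δ₂ fc hfc]
      exact Ne.symm hfp
  obtain ⟨k₀, hk₀, hne⟩ := key
  set g : (Fin 2 → ℝ) → ℝ := fun k => ‖fc k - fc (k + p)‖ ^ 2 with hg
  have hg_cont : Continuous g := by
    rw [hg]
    fun_prop
  have hg0 : 0 < g k₀ := by
    rw [hg]
    exact pow_pos (norm_pos_iff.2 (sub_ne_zero.2 hne)) 2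
  -- a ball around `k₀` on which `g > 0`
  obtain ⟨r, hr, hball⟩ : ∃ r > 0, ∀ k, dist k k₀ < r → 0 < g k := by
    have hev := hg_cont.continuousAt.eventually (lt_mem_nhds hg0)
    obtain ⟨r, hr, h⟩ := Metric.eventually_nhds_iff.1 hev
    exact ⟨r, hr, fun k hk => h hk⟩
  set r' : ℝ := min r (Real.pi / 2) with hr'
  have hr'pos : 0 < r' := lt_min hr (half_pos Real.pi_pos)
  have hsub : Metric.ball k₀ r' ⊆ Function.support g ∩ brillouin 2 := by
    intro k hk
    rw [Metric.mem_ball] at hk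
    refine ⟨(hball k (hk.trans_le (min_le_left _ _))).ne', ?_⟩
    have hki : ∀ i, dist (k i) (k₀ i) < Real.pi / 2 := fun i =>
      (dist_le_pi_dist k k₀ i).trans_lt (hk.trans_le (min_le_right _ _))
    refine Set.mem_univ_pi.2 fun i => ?_
    have h1 := hki i
    rw [Real.dist_eq] at h1
    have h2 := hk₀ i
    constructor
    · nlinarith [abs_le.1 h2, abs_lt.1 h1]
    · nlinarith [abs_le.1 h2, abs_lt.1 h1]
  have hint : IntegrableOn g (brillouin 2) volume :=
    hg_cont.continuousOn.integrableOn_compact (isCompact_brillouin 2)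
  change 0 < ∫ k in brillouin 2, g k
  rw [setIntegral_pos_iff_support_of_nonneg_ae (ae_of_all _ fun k => by positivity) hint]
  exact lt_of_lt_of_le (Metric.measure_ball_pos volume k₀ hr'pos) (measure_mono hsub)

end Continuum

/-! ### Lattice momenta: the carry of a sum, and the assembly -/

/-- Lattice momenta add up to a period: `p_{k+q} = p_k + p_q - 2π·(carry)`. [folklore] -/
theorem latticeMomentum_add_eq {L : ℕ} [NeZero L] (k q : TorusSite 2 L) :
    ∃ n : Fin 2 → ℤ, latticeMomentum L (k + q) =
      fun i => (latticeMomentum L k i + latticeMomentum L q i) + 2 * Real.pi * (n i : ℝ) := by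
  refine ⟨fun i => -((((k i).val + (q i).val) / L : ℕ) : ℤ), funext fun i => ?_⟩
  have hL : (L : ℝ) ≠ 0 := by exact_mod_cast NeZero.ne L
  have hval : ((k + q) i).val = ((k i).val + (q i).val) % L := by
    rw [Pi.add_apply, ZMod.val_add]
  have hmod : ((((k i).val + (q i).val) % L : ℕ) : ℝ) =
      ((k i).val : ℝ) + ((q i).val : ℝ) - (L : ℝ) * ((((k i).val + (q i).val) / L : ℕ) : ℝ) := by
    have h := Nat.div_add_mod ((k i).val + (q i).val) L
    have h' : (L : ℝ) * ((((k i).val + (q i).val) / L : ℕ) : ℝ) +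
        ((((k i).val + (q i).val) % L : ℕ) : ℝ) = ((k i).val : ℝ) + ((q i).val : ℝ) := by
      exact_mod_cast h
    linarith
  unfold latticeMomentum
  rw [hval, hmod, Int.cast_neg, Int.cast_natCast]
  field_simp
  ring

/-- **Positivity of the kernel structure factor away from zero momentum** (hypothesis (K2) of the
kernel symbol inequality; see the module docstring).  For `μ ∈ (-4,4)`, `Δ₁Δ₂ ≠ 0` and `r₀ > 0`
there are `s₀ > 0` and `L₀` such that for all even `L ≥ L₀`, with the crux-3 symbols `ξ, Δ, E` of
side `L`, every `q` whose lattice momentum is at sup-distance `≥ r₀` from `2πℤ²` has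
`s₀ ≤ N⁻¹ Σ_k |Δ_k/E_k - Δ_{k+q}/E_{k+q}|²`. [folklore] -/
theorem kernelSymbol_pos_far : ∀ (μ Δ₁ Δ₂ r₀ : ℝ), μ ∈ Set.Ioo (-4 : ℝ) 4 → Δ₁ ≠ 0 → Δ₂ ≠ 0 → 0 < r₀ → ∃ s₀ : ℝ, 0 < s₀ ∧ ∃ L₀ : ℕ, ∀ (L : ℕ) [NeZero L], L₀ ≤ L → Even L → ∀ (ξ E : Literature.Probability.LatticeModels.TorusSite 2 L → ℝ) (Δ : Literature.Probability.LatticeModels.TorusSite 2 L → ℂ), (∀ k, ξ k = -2 * Real.cos (Literature.Probability.LatticeModels.latticeMomentum L k 0) - 2 * Real.cos (Literature.Probability.LatticeModels.latticeMomentum L k 1) - μ) → (∀ k, Δ k = ((2 * Δ₁ * (Real.cos (Literature.Probability.LatticeModels.latticeMomentum L k 0) - Real.cos (Literature.Probability.LatticeModels.latticeMomentum L k 1)) : ℝ) : ℂ) - 4 * Complex.I * ((Δ₂ * Real.sin (Literature.Probability.LatticeModels.latticeMomentum L k 0) * Real.sin (Literature.Probability.LatticeModels.latticeMomentum L k 1)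 : ℝ) : ℂ)) → (∀ k, E k = Real.sqrt (ξ k ^ 2 + ‖Δ k‖ ^ 2)) → ∀ q : Literature.Probability.LatticeModels.TorusSite 2 L, (∀ n : Fin 2 → ℤ, r₀ ≤ dist (Literature.Probability.LatticeModels.latticeMomentum L q) (fun i => 2 * Real.pi * (n i : ℝ))) → s₀ ≤ ((L ^ 2 : ℕ) : ℝ)⁻¹ * ∑ k : Literature.Probability.LatticeModels.TorusSite 2 L, ‖Δ k / (E k : ℂ) - Δ (k + q) / (E (k + q) : ℂ)‖ ^ 2 := by
  intro μ Δ₁ Δ₂ r₀ hμ h₁ h₂ hr₀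
  -- the continuum symbol and the integrand (as opaque locals with defining equations)
  obtain ⟨fc, hfc⟩ : ∃ fc : (Fin 2 → ℝ) → ℂ, ∀ p, fc p =
      (((2 * Δ₁ * (Real.cos (p 0) - Real.cos (p 1)) : ℝ) : ℂ) -
        4 * Complex.I * ((Δ₂ * Real.sin (p 0) * Real.sin (p 1) : ℝ) : ℂ)) /
      ((Real.sqrt ((-2 * Real.cos (p 0) - 2 * Real.cos (p 1) - μ) ^ 2 +
        ‖((2 * Δ₁ * (Real.cos (p 0) - Real.cos (p 1)) : ℝ) : ℂ) -
          4 * Complex.I * ((Δ₂ * Real.sin (p 0) * Real.sin (p 1) : ℝ) : ℂ)‖ ^ 2) : ℝ) : ℂ) :=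
    ⟨_, fun p => rfl⟩
  have hcont := continuous_symbolC μ Δ₁ Δ₂ hμ h₁ h₂ fc hfc
  have hper := symbolC_periodic μ Δ₁ Δ₂ fc hfc
  obtain ⟨Gc, hGc⟩ : ∃ Gc : (Fin 2 → ℝ) → (Fin 2 → ℝ) → ℝ, ∀ k p, Gc k p = ‖fc k - fc (k + p)‖ ^ 2 :=
    ⟨_, fun k p => rfl⟩
  have hGfun : Gc = fun k p => ‖fc k - fc (k + p)‖ ^ 2 := funext fun k => funext fun p => hGc k p
  have hGcont : Continuous (fun z : (Fin 2 → ℝ) × (Fin 2 → ℝ) => Gc z.1 z.2) := by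
    rw [hGfun]
    fun_prop
  have hGper : ∀ (k y : Fin 2 → ℝ) (n : Fin 2 → ℤ),
      Gc (fun i => k i + 2 * Real.pi * (n i : ℝ)) y = Gc k y := by
    intro k y n
    rw [hGc, hGc]
    have e2 : (fun i => k i + 2 * Real.pi * (n i : ℝ)) + y = fun i => (k + y) i + 2 * Real.pi * (n i : ℝ) := by
      funext i; simp only [Pi.add_apply]; ring
    rw [hper k n, e2, hper (k + y) n]
  -- the compact parameter set
  set C : Set (Fin 2 → ℝ) := (Set.pi Set.univ fun _ => Set.Icc (0 : ℝ) (2 * Real.pi)) ∩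
    {p | ∀ n : Fin 2 → ℤ, r₀ ≤ dist p (fun i => 2 * Real.pi * (n i : ℝ))} with hC
  have hCc : IsCompact C := by
    refine (isCompact_univ_pi fun _ => isCompact_Icc).inter_right ?_
    have : {p : Fin 2 → ℝ | ∀ n : Fin 2 → ℤ, r₀ ≤ dist p (fun i => 2 * Real.pi * (n i : ℝ))} =
        ⋂ n : Fin 2 → ℤ, {p | r₀ ≤ dist p (fun i => 2 * Real.pi * (n i : ℝ))} := by
      ext p; simp
    rw [this]
    exact isClosed_iInter fun n => isClosed_le continuous_const (continuous_id.dist continuous_const)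
  -- the continuum structure factor, continuous and positive on `C`
  obtain ⟨I, hI⟩ : ∃ I : (Fin 2 → ℝ) → ℝ, ∀ y, I y = ∫ k in brillouin 2, Gc k y := ⟨_, fun y => rfl⟩
  have hIcont : Continuous I := by
    have hunc : Continuous (Function.uncurry fun (y k : Fin 2 → ℝ) => Gc k y) :=
      hGcont.comp continuous_swap
    have h := continuous_parametric_integral_of_continuous (μ := volume) hunc (isCompact_brillouin 2)
    rw [show I = fun y => ∫ k in brillouin 2, Gc k y from funext hI]
    exact h
  have hIpos : ∀ y ∈ C, 0 < I y := by
    intro y hy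
    have hy' : ∀ n : Fin 2 → ℤ, y ≠ fun i => 2 * Real.pi * (n i : ℝ) := by
      intro n hn
      have h := hy.2 n
      rw [hn, dist_self] at h
      exact absurd h (not_le.2 hr₀)
    rw [hI]
    have h := setIntegral_symbolC_diff_pos μ Δ₁ Δ₂ hμ h₁ h₂ fc hfc hy'
    simpa only [hGc] using h
  -- empty parameter set: vacuous
  by_cases hCne : C.Nonempty
  swap
  · refine ⟨1, one_pos, 0, fun L _ _ _ ξ E Δ hξ hΔ hE q hq => ?_⟩
    exfalso
    refine hCne ⟨latticeMomentum L q, ?_, hq⟩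
    exact Set.mem_univ_pi.2 fun i => lyap_latticeMomentum_mem q i
  -- the positive minimum and the Riemann approximation
  obtain ⟨y₀, hy₀, hmin⟩ := hCc.exists_isMinOn hCne hIcont.continuousOn
  have hI₀ : 0 < I y₀ := hIpos y₀ hy₀
  have h2π : (0 : ℝ) < (2 * Real.pi) ^ 2 := by positivity
  set s₀ : ℝ := ((2 * Real.pi) ^ 2)⁻¹ * I y₀ / 2 with hs₀
  have hs₀pos : 0 < s₀ := by positivity
  obtain ⟨L₀, hL₀⟩ := momentumAverage_uniform_approx (d := 2) (E := ℝ) hCc (G := Gc)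
    hGcont.continuousOn hGper hs₀pos
  refine ⟨s₀, hs₀pos, L₀, fun L _ hL hev ξ E Δ hξ hΔ hE q hq => ?_⟩
  have hy : latticeMomentum L q ∈ C :=
    ⟨Set.mem_univ_pi.2 fun i => lyap_latticeMomentum_mem q i, hq⟩
  have happ := hL₀ L hL hev (latticeMomentum L q) hy
  -- identify the lattice sum with the momentum average of `Gc`
  have hterm : ∀ k : TorusSite 2 L, ‖Δ k / (E k : ℂ) - Δ (k + q) / (E (k + q) : ℂ)‖ ^ 2 =
      Gc (latticeMomentum L k) (latticeMomentum L q) := by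
    intro k
    obtain ⟨n, hn⟩ := latticeMomentum_add_eq k q
    have e1 : Δ k / (E k : ℂ) = fc (latticeMomentum L k) := by
      rw [hfc, hE, hξ, hΔ]
    have e2 : Δ (k + q) / (E (k + q) : ℂ) = fc (latticeMomentum L k + latticeMomentum L q) := by
      rw [← hper (latticeMomentum L k + latticeMomentum L q) n, hfc, hE, hξ, hΔ, hn]
      simp only [Pi.add_apply]
    rw [hGc, e1, e2]
  have hsum : ((L ^ 2 : ℕ) : ℝ)⁻¹ * ∑ k : TorusSite 2 L, ‖Δ k / (E k : ℂ) - Δ (k + q) / (E (k + q) : ℂ)‖ ^ 2 =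
      ((L ^ 2 : ℕ) : ℝ)⁻¹ * ∑ k : TorusSite 2 L, Gc (latticeMomentum L k) (latticeMomentum L q) := by
    congr 1
    exact Finset.sum_congr rfl fun k _ => hterm k
  rw [hsum]
  have hab := abs_le.1 (by simpa [Real.norm_eq_abs, smul_eq_mul] using happ)
  have hmin' : I y₀ ≤ I (latticeMomentum L q) := hmin hy
  have hcmp : ((2 * Real.pi) ^ 2)⁻¹ * I y₀ ≤
      ((2 * Real.pi) ^ 2)⁻¹ * ∫ k in brillouin 2, Gc k (latticeMomentum L q) := by
    rw [← hI (latticeMomentum L q)]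
    exact mul_le_mul_of_nonneg_left hmin' (by positivity)
  have hN : ((L ^ 2 : ℕ) : ℝ) = (L : ℝ) ^ 2 := by push_cast; ring
  rw [hN]
  linarith [hab.1]

end BirBdG

end Summit.HubbardSuperconductivity.HubbardSuperconductivity.Theorems

end
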